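import Summits.QuantumFields.YangMills.Theorems.BalabanUVNodesN11NodeFacesOfSupplyChainTokens
import Summits.QuantumFields.YangMills.Theorems.BalabanUVNodesN11SupplyChainAtCRLetteredMemberOfBgFactsB

/-!
# DAG node N11 — N11's NODE FACES AT THE cR-LETTERED MEMBER's HISTORY-BLIND DOOR ON THE GUARD-FREE bg ROAD: the ∀-run TOKEN FAMILY on the window, N11's DAG node
# `Dag.B14_main (leavesP w P)` at every run of every world bound to the datum, the thirteen-nodes ceiling transfer, and dag-n24-c's `h11`-shaped (S1ᵀ) child family — at
# `θᴳ_c := gaussPinH (ofHistoryBlind ⟨θ₁₃(n_c, ε₂₉), ZrOfRecord₁₃ …⟩)`, `n_c := {θ₁₅ᶜᶜᴹᵂ(j; γ)'s numerics with s2.cR := c}`, `c ∈ [2, 8]`, `j + 1 ≤ F.m`, from Part 14 §0c's K0-side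
# letters + K0's per-cube solvability + [III] §3's supplier on the windowed runs — NOTHING ELSE (no key, no bg binder, no run guard, no numeric row)

HEADER — WORK-UNIT METADATA.  Cell `pub-ymgap`, YM-PLAN Track A (HUMAN RULING D-0062 ∕ D-0149 width seats), seat `pub-ymgap-dag-n11-w3` (g5; WIDTH SEAT 3∕4 on NODE n11 [B14]),
route `BalabanUVNodes` rev 29, item K1⁹ `StabilityBRunRowsAtRecordR13SepCoPHV` = stmt-QuantumFields-27364 (helper lane `--kind proof --supports 27364 --as helper`, count-neutral).
Third sequel of the DEDUP-394 (1) split (pub-ymgap INBOX 2026-08-28 I.36868) — «the ∀-run packaging into n11-w1 g4's `hN` + their sockets AT THE cR-LETTERED MEMBER's door» (this seat's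
FILED-1′ I.37296).  [III] = [Balaban1988Convergent], [15] = [Balaban1985Variational], [I] = [Balaban1987RG1], [IV] = [Balaban1989LargeFieldI], [V] = [Balaban1989LargeFieldII].  Over (BY
NAME, nothing restated): dag-n11-w1 g4 `…N11NodeFacesOfSupplyChainTokens` §1 (the ROAD-AGNOSTIC sockets `b14_main_leavesP_all_of_supplyChainAt_family`,
`nodes_leavesP_withCeiling_of_supplyChainAt_family`, `h11Family_of_supplyChainAt_family` from a Step-window token family `hN`); this seat's p631283
`…N11SupplyChainAtCRLetteredMemberOfBgFacts` §2 (★★★★ `supplyChainAt_gaussPinH_door_ccmwCR_of_supplierBorel_of_betaBox` — the per-run token at θᴳ_c, key included); g4 p619867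
(`ccmwCR_pos`) and p620936 (★★★★ `provisos₁₃SepCoPH_door_ccmwCR_of_gauge9TopStepR_of_betaBoxSignFree_allTorus` — the key at the door); g0 `…GaussianCertificateDefs`
(`provisos₁₃CoPH_gaussPinH`); dag-n11-w1 `…BorelBThm1PrintedOfSolvable` (`provisos₁₃SepCoPH_gaussPinH`).

WHY THIS FILE.  p631283 §2 gives N11's token PER WINDOW RUN at θᴳ_c under per-run solvability ∕ supplier; dag-n11-w1 g4's sockets turn a Step-window token FAMILY
`hN : ∀ P, Step.InInterval γ P.K (gOfRecord₁₃ θ P) → SupplyChainAt θ P` into the faces the consumers read — dag-n11-d's node `Dag.B14_main (leavesP w P)` at worlds bound to the datum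
(K1 v9 LINE 1 `stub_nodes13PWS`'s N11 conjunct), the thirteen-nodes ceiling transfer, dag-n24-c's K1⁹-by-name binder `h11`.  THIS FILE packages p631283 §2 over the windowed runs
(solvability and supplier quantified over the window, as in dag-n11-w5's (b)) into `hN` at θᴳ_c and instantiates the three sockets there: N11's consumer-facing faces at the
cR-lettered member's door from Part 14 §0c's letters ((8), the (9)-step, the sign-free β-box), `c ∈ [2, 8]`, K0's per-cube [15]-solvability and [III] §3's supplier on the windowed
runs — and an arbitrary proof `hG` of the door key to NAME the datum (inhabited by g4's door theorem; the faces are proof-irrelevant in it).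

SIBLING MODULE (director-ym №365 RENAME-AND-REDIRECT, 2026-08-30): this is `…BalabanUVNodesN11NodeFacesAtCRLetteredMemberDoorOfBgFactsB`, the residue-free sibling of `…BalabanUVNodesN11NodeFacesAtCRLetteredMemberDoorOfBgFacts` — SAME short decl names, the displayed [15]
hypotheses re-typed to the ᴮ tokens (dag-n11-w1's R-road convention `(floorGuard F c₁₅, lamDatum F, Dat)` + ONE data-transfer binder `hDat₀`) and the Stage-2 SEAM displayed as ONE
hypothesis `hseam` (so the file is green BEFORE and AFTER node00-def-R's seam edit; post-seam users pass `fun _ _ _ _ _ => by rw [UbgOfRecord₁₃CoP_succ]`); imports re-pointed to the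
residue-free twins `…K0DoorAtCRLetteredNumerics{,Z}B` ∕ `…BgRowGaugeRAtCRLetteredMemberB`, the letters bundles `…CRLetteredMemberLetters{,Z}` and the lower siblings.  The old module
is NOT edited (residue after the seam, R556 attic).  Count-neutral; nothing of Bałaban asserted.
WHAT THIS FILE PROVES (5 theorems, 0 `def`, 0 `sorry`; standard axioms; compositions BY NAME).
§1 ★★★ `supplyChainAt_family_gaussPinH_door_ccmwCR_of_supplierBorel_of_betaBox` (the Step-window token FAMILY `hN` at θᴳ_c).
§2 ★★★★ `b14_main_leavesP_all_gaussPinH_door_ccmwCR_of_supplierBorel_of_betaBox` (`∀ P, Dag.B14_main (leavesP w P)` at every world `w` with `w.C = (datumOfRecord₁₃SepCoPH F N θᴳ_c _).C`,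
   `w.γ ≤ γ`) · ★★★ `nodes_leavesP_withCeiling_gaussPinH_door_ccmwCR_of_supplierBorel_of_betaBox` (nodes at `w` ⇒ nodes at every `withCeiling w c′`).
§3 ★★★★ `h11Family_gaussPinH_door_ccmwCR_of_supplierBorel_of_betaBox` (dag-n24-c's `h11` SHAPE VERBATIM at θᴳ_c: `∀ βup β₀, ∃ γ₁₁ > 0, ∀ w, w.C = (datumOfRecord₁₃SepCoPH θᴳ_c _).C → … →
   ∀ k < K, SLaw₁₃CoPH θᴳ_c P k → TLaw₁₃CoPH θᴳ_c P k`, witnessed by `γ₁₁ := γ`).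
§4 ★★★★ `exists_window_h11Family_gaussPinH_door_ccmwCR_of_betaBox` — «γ sufficiently small» QUANTIFIED for §3 (`∃ γ₁₁ⁿᵘᵐ(L, j, N) > 0`, g3 p608030 §1): key holds ∧ ∀ key proof, the family.

HONEST FRAMING ∕ A6.  Helper lane, count-neutral KERNEL BOOKKEEPING (λ-packaging + three applications of dag-n11-w1 g4's sockets after the `rfl` selector clause and the member's
numerals `κ = 2·10⁴`, `E₀ = B₀ = 1`, `M = L^j ≥ 1`); nothing of Bałaban ([III] ∕ [15] ∕ [I]) is asserted.  DISPLAYED (hypotheses, NOT discharged, inhabited nowhere in the tree): (8)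
`VariationalThm1RegSepCoP7M`, the (9)-step `Gauge9RegSepTopStepR`, the sign-free windowed β-box of `betaOfRecord₁₃ F N θ₁₅ᶜᶜᴹᵂ(j; γ)` (`−bₗ·γ² ≤ 3`, `β′·γ² ≤ ¾`; K0⁷'s stub territory),
K0's per-cube [15]-solvability on the windowed runs, [III] §3's supplier (`SupplierObligations ∧ SupplierBorel` — XL, nobody's theorem) on the windowed runs; the key binder `hG` is
INHABITED (g4's door theorem) and only names the datum.  Of the node's leaf antecedents only `smallCouplings` is read (§3: `βup ∕ β₀ ∕ b7…b11 ∕ smallFieldInductive ∕ flowControl`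
UNREAD — as in the socket).  Non-wrapping families only (`j + 1 ≤ F.m`).  NOT a re-pin (no `def`); N11 NOT discharged; K0⁷ ∕ K1⁹ NOT closed, no v9 stub touched; counts unmoved
(typed 28∕28 · discharged 5∕27 · A 5∕28).  One finite `𝕋⁴_{L^K}` programme at fixed `ε = L^{−K}`; `route-QuantumFields-BalabanUVNodes` closes ONLY the CONDITIONAL finite-𝕋⁴ rung
`BalabanLadder.UV` — NOT ℝ⁴, NOT OS, NOT the Yang–Mills mass gap (Clay).  No `sorry`, no `axiom`, no `def`, no `instance`, no `notation`.
Sources (SHAPE only): [III] Thm 1 p.262, Theorem p.245, p.244 L36–38, remark p.262, §3 p.279, (2.6) p.255, (2.10) p.256, (2.28) p.259, (3.16)–(3.25) pp.268–270; [15] Thm 1 (7)–(9)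
pp.278–279, (144)–(152) pp.300–301, Prop. 8 p.304; [I] Thm 1 p.259, (0.20) p.256, (1.20)–(1.22) p.264; [IV] (0.2)–(0.4) p.176, p.177 (i)–(ii); [V] Thm 1 + (0.1) pp.355–356.
-/

noncomputable section

open MeasureTheory
open scoped BigOperators ENNReal NNReal Matrix.Norms.L2Operator

namespace Summit.QuantumFields.YangMills.Theorems.BalabanUVNodesN11NodeFacesAtCRLetteredMemberDoorOfBgFactsB

open Literature.MathematicalPhysics.QuantumFieldTheory.Balaban1983to89 T4Continuum T4NestedCovariance Node00 Node00.Tk DagBinding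
open B15DeterminingSets B8Eq17ClassAkV1 B14.Eq218Concrete B10Eq42TorusConstraint FlowStep
open B14.Eq213DetSet (Bj)
open Literature.MathematicalPhysics.QuantumFieldTheory.BalabanImbrieJaffe1984to88.BIJ85Eq453GaugeField (qsstarGIter0)
open Summit.QuantumFields.YangMills.Theorems.StabilityBAtRecordR13SepCoPH.Negative.SignBoxAtEveryWitnessFalse (withCeiling)
open BalabanUVNodesN11HistoryPinnedResidualDefs BalabanUVNodesN11RePinnedParamDefs
open BalabanUVNodesN11GaussianCertificateDefs (gaussPinH provisos₁₃CoPH_gaussPinH)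
open BalabanUVNodesN11Sect3SupplyChainDefs
open BalabanUVNodesN11Sect3SupplyChainBorelB
open BalabanUVNodesN11Sect3SupplyChainObligationsDefs
open BalabanUVNodesN11Sect3SupplyChainBorelBThm1PrintedOfSolvable (provisos₁₃SepCoPH_gaussPinH)
open BalabanUVNodesN11SupplyChainAtCRLetteredNumerics (ccmwCR_pos)
open BalabanUVNodesN11K0DoorAtCRLetteredNumericsB (hAdm_floorGuard_ccmwCR provisos₁₃SepCoPH_door_ccmwCR_of_gauge9TopStepGB_of_betaBoxSignFree_allTorus_lam)
open BalabanUVNodesN11CRLetteredMemberLetters (letters_ccmwCR)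
open BalabanUVNodesN11SupplyChainAtCRLetteredMemberOfBgFactsB (supplyChainAt_gaussPinH_door_ccmwCR_of_supplierBorel_of_betaBox)
open BalabanUVNodesN11NodeFacesOfSupplyChainTokens (b14_main_leavesP_all_of_supplyChainAt_family nodes_leavesP_withCeiling_of_supplyChainAt_family h11Family_of_supplyChainAt_family)
open BalabanUVNodesN11NoExpansionNumericsAtThm1CCMW (exists_window_ccmShape)

variable {F : T4Family} {N : ℕ} [NeZero N] {j c₁₅ : ℕ} {γ c ε₀ ε₂₉ B₃ B₃' a₀ a₁ bl β' : ℝ} {θ₀ : Stage13Params F N} {Dat : TopData F N}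

/-! ## §1  The Step-window token family at the member's history-blind door -/

/-- **★★★ THE STEP-WINDOW TOKEN FAMILY `hN` AT THE cR-LETTERED MEMBER's HISTORY-BLIND DOOR** — `∀ P, Step.InInterval γ P.K (gOfRecord₁₃ θ₀ P) → SupplyChainAt θᴳ_c P`,
`θᴳ_c := gaussPinH (ofHistoryBlind ⟨θ₀, ZrOfRecord₁₃ θ₀⟩)`, `θ₀ = θ₁₃(n_c, ε₂₉)` — from Part 14 §0c's letters, `c ∈ [2, 8]`, `1 ≤ j`, `j + 1 ≤ F.m`, the four γ-conditions + `γ ≤ e^{−1}`, and,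
QUANTIFIED OVER THE WINDOWED RUNS, K0's per-cube [15]-solvability and [III] §3's supplier with `SupplierObligations ∧ SupplierBorel` (p631283 §2 packaged; the currency of dag-n11-w1 g4's
sockets).  CONDITIONAL; nothing of Bałaban asserted.
[cite: Balaban1988Convergent, Thm 1 p.262, Theorem p.245, §3 p.279, (2.10) p.256, (2.28) p.259, (3.16)–(3.25) pp.268–270; Balaban1985Variational, Thm 1 (7)–(9) pp.278–279, (144)–(152) pp.300–301, Prop. 8 p.304; Balaban1987RG1, Thm 1 p.259, (0.20) p.256, (1.20)–(1.22) p.264; Balaban1989LargeFieldI, (0.2)–(0.4) p.176] -/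
theorem supplyChainAt_family_gaussPinH_door_ccmwCR_of_supplierBorel_of_betaBox
    (hθ₀ : θ₀ = theta13LiveOfNumerics F N
      ({ stage12NumericsOfThm1CCMW F.L j γ ε₀ B₃ B₃' a₀ a₁ with s2 := { sect2NumericsOfThm1C F.L with cR := c } } : Stage12Numerics) ε₂₉
      (zeta316OfRecord F N (stage12NumericsOfThm1CCMW F.L j γ ε₀ B₃ B₃' a₀ a₁).ν (stage12NumericsOfThm1CCMW F.L j γ ε₀ B₃ B₃' a₀ a₁).τ9.M
        (stage12NumericsOfThm1CCMW F.L j γ ε₀ B₃ B₃' a₀ a₁).A₁) (RzOfRecord F N) (ZtOfRecord F N))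
    (hjm : j + 1 ≤ F.m) (hc2 : 2 ≤ c) (hc8 : c ≤ 8) (hj : 1 ≤ j) (hε : 0 < ε₀) (hε' : 0 < ε₂₉) (hB : 0 ≤ B₃) (hB' : 0 ≤ B₃') (ha₀ : 0 < a₀) (ha₁ : 0 < a₁)
    (hγ0 : 0 < γ) (hγe : γ ≤ Real.exp (-1))
    (h3γ : 3 * (F.L : ℝ) ^ j ≤ F.L * Real.log (γ ^ 2)⁻¹) (hRγ : ((8 * F.L + 3 : ℕ) : ℝ) ≤ F.L * Real.log (γ ^ 2)⁻¹)
    (hε3γ : 36608 * (γ * Real.log (γ ^ 2)⁻¹) ≤ 16 / 3) (hε2γ : γ * Real.log (γ ^ 2)⁻¹ ≤ 16 * ExpMeanLog.deltaSU (Fin N) / ((8 * F.L : ℕ) : ℝ) ^ 2)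
    (h15 : VariationalThm1RegSepCoP7MGB F N (floorGuard F c₁₅) (lamDatum F) Dat B₃ a₀ a₁) (hc₁₅ : c₁₅ ≤ F.L ^ j)
    (h9 : Gauge9RegSepTopStepGB F N (fun ν K Ω => suppDomOfRecord F ν K Ω) (F.L ^ j) (floorGuard F c₁₅) (lamDatum F) Dat B₃ B₃' a₀ a₁)
    (hDat₀ : ∀ (θ' : Stage13Params F N) (p : B12.RunParams) (n : ℕ) (s : SeqOfRecord F θ'.ν θ'.τ9.M (gOfRecord₁₃ F N θ' p) p.K n) (δ : ℕ → ℝ) (W : MSField (F.P p.K) (SU N)),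
      n ≤ p.K → Sect2.DataSmall7PTop (avOfRecord F N p.K) s.Ω (suppDomOfRecord F θ'.ν p.K s.Ω) n δ W → Dat p.K s.Ω (suppDomOfRecord F θ'.ν p.K s.Ω) n δ W)
    (hseam : ∀ (θ' : Stage13Params F N) (p : B12.RunParams) (n : ℕ) (s : SeqOfRecord F θ'.ν θ'.τ9.M (gOfRecord₁₃ F N θ' p) p.K (n + 1)) (W : MSField (F.P p.K) (SU N)),
      UbgOfRecord₁₃CoP F N θ' p (n + 1) s W = UbgMSCoPOfRecordB F N θ'.ν θ'.τ9.M (gOfRecord₁₃ F N θ' p) p.K (n + 1) s W)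
    (hbox : BetaLowerH bl γ (betaOfRecord₁₃ F N (theta13OfThm1CCMW F N j γ ε₀ ε₂₉ B₃ B₃' a₀ a₁)))
    (hbox' : BetaUpperH β' γ (betaOfRecord₁₃ F N (theta13OfThm1CCMW F N j γ ε₀ ε₂₉ B₃ B₃' a₀ a₁))) (hl : -bl * γ ^ 2 ≤ 3) (hβ' : β' * γ ^ 2 ≤ 3 / 4)
    (hsolv : ∀ P : B12.RunParams, Step.InInterval γ P.K (gOfRecord₁₃ F N θ₀ P) → ∀ i, 1 ≤ i → i ≤ P.K →
      ∀ (s : SeqOfRecord F θ₀.ν θ₀.τ9.M (gOfRecord₁₃ F N θ₀ P) P.K i) (V : GaugeField (F.P P.K) i (SU N)),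
      chiSeqOfRecord F N θ₀.ν θ₀.τ9.M (gOfRecord₁₃ F N θ₀ P) P.K i s V ≠ 0 →
      ∀ a ∈ cubesIn (fun a : ↥(cubeIndices (F.P P.K) (cubeSide (F.P P.K).L θ₀.ν.M₂ (RkOfRecord (F.P P.K).L θ₀.ν.r (gOfRecord₁₃ F N θ₀ P i)) i)) =>
          cubeEnl (F.P P.K) (cubeSide (F.P P.K).L θ₀.ν.M₂ (RkOfRecord (F.P P.K).L θ₀.ν.r (gOfRecord₁₃ F N θ₀ P i)) i) a 0) (s.Ω i),
        ∃ U₀, IsMinimizer (avOfRecord F N P.K) {U | PlaqSmall (θ₀.ν.εreg * (F.P P.K).eta i ^ 2) U}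
          (Bj θ₀.ν.M₁ (cubeEnl (F.P P.K) (cubeSide (F.P P.K).L θ₀.ν.M₂ (RkOfRecord (F.P P.K).L θ₀.ν.r (gOfRecord₁₃ F N θ₀ P i)) i) a 4) i)
          (avgFamily (avOfRecord F N P.K) (qsstarGIter0 i V)) U₀)
    (σ : (P : B12.RunParams) → Sect3Supplier (gaussPinH (Stage13HParams.ofHistoryBlind F N ⟨θ₀, ZrOfRecord₁₃ F N θ₀⟩)) P)
    (hσ : ∀ P : B12.RunParams, Step.InInterval γ P.K (gOfRecord₁₃ F N θ₀ P) → SupplierObligations (gaussPinH (Stage13HParams.ofHistoryBlind F N ⟨θ₀, ZrOfRecord₁₃ F N θ₀⟩)) P (σ P))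
    (hσB : ∀ P : B12.RunParams, Step.InInterval γ P.K (gOfRecord₁₃ F N θ₀ P) → SupplierBorel (gaussPinH (Stage13HParams.ofHistoryBlind F N ⟨θ₀, ZrOfRecord₁₃ F N θ₀⟩)) P (σ P)) :
    ∀ P : B12.RunParams, Step.InInterval γ P.K (gOfRecord₁₃ F N (gaussPinH (Stage13HParams.ofHistoryBlind F N ⟨θ₀, ZrOfRecord₁₃ F N θ₀⟩)).toStage13Params P) →
      SupplyChainAt (gaussPinH (Stage13HParams.ofHistoryBlind F N ⟨θ₀, ZrOfRecord₁₃ F N θ₀⟩)) P := fun P hw =>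
  supplyChainAt_gaussPinH_door_ccmwCR_of_supplierBorel_of_betaBox hθ₀ hjm hc2 hc8 hj hε hε' hB hB' ha₀ ha₁ hγ0 hγe h3γ hRγ hε3γ hε2γ h15 hc₁₅ h9 hDat₀ hseam hbox hbox' hl hβ'
    P hw (hsolv P hw) (σ P) (hσ P hw) (hσB P hw)

/-! ## §2  N11's DAG node at every run of every world bound to the datum; the thirteen-nodes ceiling transfer -/

/-- **★★★★ N11's DAG NODE `Dag.B14_main (leavesP w P)` AT EVERY RUN OF EVERY WORLD BOUND TO THE DATUM OF θᴳ_c WITH `w.γ ≤ γ`** — the N11 conjunct K1 v9 LINE 1 reads at an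
S-bound world — at the cR-LETTERED MEMBER's HISTORY-BLIND DOOR: dag-n11-w1 g4's socket `b14_main_leavesP_all_of_supplyChainAt_family` on §1's family (the member's selector clause
`rfl`, admissibility from `ccmwCR_pos`, numerals `κ = 2·10⁴`, `E₀ = B₀ = 1`, `M = L^j ≥ 1`).  `hG` = ANY proof of the door key (inhabited by g4's
`provisos₁₃SepCoPH_door_ccmwCR_of_gauge9TopStepR_of_betaBoxSignFree_allTorus`; the face is proof-irrelevant in it) — it only NAMES the datum `datumOfRecord₁₃SepCoPH … (provisos₁₃SepCoPH_gaussPinH hG)`.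
Displayed: Part 14 §0c's letters, `c ∈ [2, 8]`, `1 ≤ j`, `j + 1 ≤ F.m`, the γ-conditions, and ON THE WINDOWED RUNS K0's per-cube [15]-solvability and [III] §3's supplier — NOTHING ELSE.
CONDITIONAL; nothing of Bałaban asserted; NOT a discharge of N11.
[cite: Balaban1988Convergent, Thm 1 p.262, Theorem p.245, p.244 L36–38, §3 p.279, (2.10) p.256, (2.28) p.259, (3.16)–(3.25) pp.268–270; Balaban1989LargeFieldII, Introduction pp.355–356; Balaban1989LargeFieldI, (0.3)–(0.4) p.176, p.177 (i)–(ii); Balaban1985Variational, Thm 1 (7)–(9) pp.278–279, (144)–(152) pp.300–301; Balaban1987RG1, Thm 1 p.259, (0.20) p.256, (1.20)–(1.22) p.264] -/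
theorem b14_main_leavesP_all_gaussPinH_door_ccmwCR_of_supplierBorel_of_betaBox
    (hθ₀ : θ₀ = theta13LiveOfNumerics F N
      ({ stage12NumericsOfThm1CCMW F.L j γ ε₀ B₃ B₃' a₀ a₁ with s2 := { sect2NumericsOfThm1C F.L with cR := c } } : Stage12Numerics) ε₂₉
      (zeta316OfRecord F N (stage12NumericsOfThm1CCMW F.L j γ ε₀ B₃ B₃' a₀ a₁).ν (stage12NumericsOfThm1CCMW F.L j γ ε₀ B₃ B₃' a₀ a₁).τ9.M
        (stage12NumericsOfThm1CCMW F.L j γ ε₀ B₃ B₃' a₀ a₁).A₁) (RzOfRecord F N) (ZtOfRecord F N))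
    (hjm : j + 1 ≤ F.m) (hc2 : 2 ≤ c) (hc8 : c ≤ 8) (hj : 1 ≤ j) (hε : 0 < ε₀) (hε' : 0 < ε₂₉) (hB : 0 ≤ B₃) (hB' : 0 ≤ B₃') (ha₀ : 0 < a₀) (ha₁ : 0 < a₁)
    (hγ0 : 0 < γ) (hγe : γ ≤ Real.exp (-1))
    (h3γ : 3 * (F.L : ℝ) ^ j ≤ F.L * Real.log (γ ^ 2)⁻¹) (hRγ : ((8 * F.L + 3 : ℕ) : ℝ) ≤ F.L * Real.log (γ ^ 2)⁻¹)
    (hε3γ : 36608 * (γ * Real.log (γ ^ 2)⁻¹) ≤ 16 / 3) (hε2γ : γ * Real.log (γ ^ 2)⁻¹ ≤ 16 * ExpMeanLog.deltaSU (Fin N) / ((8 * F.L : ℕ) : ℝ) ^ 2)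
    (h15 : VariationalThm1RegSepCoP7MGB F N (floorGuard F c₁₅) (lamDatum F) Dat B₃ a₀ a₁) (hc₁₅ : c₁₅ ≤ F.L ^ j)
    (h9 : Gauge9RegSepTopStepGB F N (fun ν K Ω => suppDomOfRecord F ν K Ω) (F.L ^ j) (floorGuard F c₁₅) (lamDatum F) Dat B₃ B₃' a₀ a₁)
    (hDat₀ : ∀ (θ' : Stage13Params F N) (p : B12.RunParams) (n : ℕ) (s : SeqOfRecord F θ'.ν θ'.τ9.M (gOfRecord₁₃ F N θ' p) p.K n) (δ : ℕ → ℝ) (W : MSField (F.P p.K) (SU N)),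
      n ≤ p.K → Sect2.DataSmall7PTop (avOfRecord F N p.K) s.Ω (suppDomOfRecord F θ'.ν p.K s.Ω) n δ W → Dat p.K s.Ω (suppDomOfRecord F θ'.ν p.K s.Ω) n δ W)
    (hseam : ∀ (θ' : Stage13Params F N) (p : B12.RunParams) (n : ℕ) (s : SeqOfRecord F θ'.ν θ'.τ9.M (gOfRecord₁₃ F N θ' p) p.K (n + 1)) (W : MSField (F.P p.K) (SU N)),
      UbgOfRecord₁₃CoP F N θ' p (n + 1) s W = UbgMSCoPOfRecordB F N θ'.ν θ'.τ9.M (gOfRecord₁₃ F N θ' p) p.K (n + 1) s W)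
    (hbox : BetaLowerH bl γ (betaOfRecord₁₃ F N (theta13OfThm1CCMW F N j γ ε₀ ε₂₉ B₃ B₃' a₀ a₁)))
    (hbox' : BetaUpperH β' γ (betaOfRecord₁₃ F N (theta13OfThm1CCMW F N j γ ε₀ ε₂₉ B₃ B₃' a₀ a₁))) (hl : -bl * γ ^ 2 ≤ 3) (hβ' : β' * γ ^ 2 ≤ 3 / 4)
    (hsolv : ∀ P : B12.RunParams, Step.InInterval γ P.K (gOfRecord₁₃ F N θ₀ P) → ∀ i, 1 ≤ i → i ≤ P.K →
      ∀ (s : SeqOfRecord F θ₀.ν θ₀.τ9.M (gOfRecord₁₃ F N θ₀ P) P.K i) (V : GaugeField (F.P P.K) i (SU N)),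
      chiSeqOfRecord F N θ₀.ν θ₀.τ9.M (gOfRecord₁₃ F N θ₀ P) P.K i s V ≠ 0 →
      ∀ a ∈ cubesIn (fun a : ↥(cubeIndices (F.P P.K) (cubeSide (F.P P.K).L θ₀.ν.M₂ (RkOfRecord (F.P P.K).L θ₀.ν.r (gOfRecord₁₃ F N θ₀ P i)) i)) =>
          cubeEnl (F.P P.K) (cubeSide (F.P P.K).L θ₀.ν.M₂ (RkOfRecord (F.P P.K).L θ₀.ν.r (gOfRecord₁₃ F N θ₀ P i)) i) a 0) (s.Ω i),
        ∃ U₀, IsMinimizer (avOfRecord F N P.K) {U | PlaqSmall (θ₀.ν.εreg * (F.P P.K).eta i ^ 2) U}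
          (Bj θ₀.ν.M₁ (cubeEnl (F.P P.K) (cubeSide (F.P P.K).L θ₀.ν.M₂ (RkOfRecord (F.P P.K).L θ₀.ν.r (gOfRecord₁₃ F N θ₀ P i)) i) a 4) i)
          (avgFamily (avOfRecord F N P.K) (qsstarGIter0 i V)) U₀)
    (σ : (P : B12.RunParams) → Sect3Supplier (gaussPinH (Stage13HParams.ofHistoryBlind F N ⟨θ₀, ZrOfRecord₁₃ F N θ₀⟩)) P)
    (hσ : ∀ P : B12.RunParams, Step.InInterval γ P.K (gOfRecord₁₃ F N θ₀ P) → SupplierObligations (gaussPinH (Stage13HParams.ofHistoryBlind F N ⟨θ₀, ZrOfRecord₁₃ F N θ₀⟩)) P (σ P))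
    (hσB : ∀ P : B12.RunParams, Step.InInterval γ P.K (gOfRecord₁₃ F N θ₀ P) → SupplierBorel (gaussPinH (Stage13HParams.ofHistoryBlind F N ⟨θ₀, ZrOfRecord₁₃ F N θ₀⟩)) P (σ P))
    (hG : (Stage13HParams.ofHistoryBlind F N ⟨θ₀, ZrOfRecord₁₃ F N θ₀⟩).Provisos₁₃SepCoPH F N)
    (w : WorldP) (hC : w.C = (datumOfRecord₁₃SepCoPH F N (gaussPinH (Stage13HParams.ofHistoryBlind F N ⟨θ₀, ZrOfRecord₁₃ F N θ₀⟩)) (provisos₁₃SepCoPH_gaussPinH hG)).C)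
    (hγw : w.γ ≤ γ) : ∀ P : B12.RunParams, Dag.B14_main (leavesP w P) := by
  have hN := supplyChainAt_family_gaussPinH_door_ccmwCR_of_supplierBorel_of_betaBox hθ₀ hjm hc2 hc8 hj hε hε' hB hB' ha₀ ha₁ hγ0 hγe h3γ hRγ hε3γ hε2γ h15 hc₁₅ h9 hDat₀ hseam
    hbox hbox' hl hβ' hsolv σ hσ hσB
  subst hθ₀
  have hγ1 : γ < 1 := hγe.trans_lt (Real.exp_lt_one_iff.mpr (by norm_num))
  have hpos := ccmwCR_pos (L := F.L) (j := j) (ε₀ := ε₀) (B₃ := B₃) (B₃' := B₃') (a₀ := a₀) (a₁ := a₁) (by have := F.hL11; omega) hγ0 hγ1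
    (by linarith : (0 : ℝ) < c) hε hB hB' ha₀ ha₁
  have hadm := (admissible_theta13OfNumerics (n := ({ stage12NumericsOfThm1CCMW F.L j γ ε₀ B₃ B₃' a₀ a₁ with s2 := { sect2NumericsOfThm1C F.L with cR := c } } : Stage12Numerics)) F N
    (zeta316OfRecord F N (stage12NumericsOfThm1CCMW F.L j γ ε₀ B₃ B₃' a₀ a₁).ν (stage12NumericsOfThm1CCMW F.L j γ ε₀ B₃ B₃' a₀ a₁).τ9.M
      (stage12NumericsOfThm1CCMW F.L j γ ε₀ B₃ B₃' a₀ a₁).A₁) (RzOfRecord F N) (ZtOfRecord F N) hpos hε').liveRepin₁₃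
  have hM : 1 ≤ F.L ^ j := Nat.one_le_pow _ _ (by have := F.hL11; omega)
  have hκ : (0 : ℝ) ≤ 20000 := by norm_num
  exact b14_main_leavesP_all_of_supplyChainAt_family _ (provisos₁₃SepCoPH_gaussPinH hG).toCore rfl hadm hκ zero_le_one zero_le_one hM hN w hC hγw

/-- **★★★ THE THIRTEEN DAG NODES PASS TO EVERY CEILING AT WORLDS BOUND TO THE DATUM OF θᴳ_c** (`w.γ ≤ γ`): nodes at `w` ⇒ nodes at `withCeiling w c′` for EVERY real `c′` —
dag-n11-w1 g4's socket `nodes_leavesP_withCeiling_of_supplyChainAt_family` on §1's family at the cR-lettered member's door.  Same displayed rows as §2's node face.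
[cite: Balaban1989LargeFieldII, Introduction pp.355–356; Balaban1988Convergent, Thm 1 p.262, (2.6) p.255, (2.10) p.256, (2.28) p.259; Balaban1985Variational, Thm 1 (7)–(9) pp.278–279; Balaban1987RG1, Thm 1 p.259, (1.20)–(1.22) p.264] -/
theorem nodes_leavesP_withCeiling_gaussPinH_door_ccmwCR_of_supplierBorel_of_betaBox
    (hθ₀ : θ₀ = theta13LiveOfNumerics F N
      ({ stage12NumericsOfThm1CCMW F.L j γ ε₀ B₃ B₃' a₀ a₁ with s2 := { sect2NumericsOfThm1C F.L with cR := c } } : Stage12Numerics) ε₂₉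
      (zeta316OfRecord F N (stage12NumericsOfThm1CCMW F.L j γ ε₀ B₃ B₃' a₀ a₁).ν (stage12NumericsOfThm1CCMW F.L j γ ε₀ B₃ B₃' a₀ a₁).τ9.M
        (stage12NumericsOfThm1CCMW F.L j γ ε₀ B₃ B₃' a₀ a₁).A₁) (RzOfRecord F N) (ZtOfRecord F N))
    (hjm : j + 1 ≤ F.m) (hc2 : 2 ≤ c) (hc8 : c ≤ 8) (hj : 1 ≤ j) (hε : 0 < ε₀) (hε' : 0 < ε₂₉) (hB : 0 ≤ B₃) (hB' : 0 ≤ B₃') (ha₀ : 0 < a₀) (ha₁ : 0 < a₁)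
    (hγ0 : 0 < γ) (hγe : γ ≤ Real.exp (-1))
    (h3γ : 3 * (F.L : ℝ) ^ j ≤ F.L * Real.log (γ ^ 2)⁻¹) (hRγ : ((8 * F.L + 3 : ℕ) : ℝ) ≤ F.L * Real.log (γ ^ 2)⁻¹)
    (hε3γ : 36608 * (γ * Real.log (γ ^ 2)⁻¹) ≤ 16 / 3) (hε2γ : γ * Real.log (γ ^ 2)⁻¹ ≤ 16 * ExpMeanLog.deltaSU (Fin N) / ((8 * F.L : ℕ) : ℝ) ^ 2)
    (h15 : VariationalThm1RegSepCoP7MGB F N (floorGuard F c₁₅) (lamDatum F) Dat B₃ a₀ a₁) (hc₁₅ : c₁₅ ≤ F.L ^ j)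
    (h9 : Gauge9RegSepTopStepGB F N (fun ν K Ω => suppDomOfRecord F ν K Ω) (F.L ^ j) (floorGuard F c₁₅) (lamDatum F) Dat B₃ B₃' a₀ a₁)
    (hDat₀ : ∀ (θ' : Stage13Params F N) (p : B12.RunParams) (n : ℕ) (s : SeqOfRecord F θ'.ν θ'.τ9.M (gOfRecord₁₃ F N θ' p) p.K n) (δ : ℕ → ℝ) (W : MSField (F.P p.K) (SU N)),
      n ≤ p.K → Sect2.DataSmall7PTop (avOfRecord F N p.K) s.Ω (suppDomOfRecord F θ'.ν p.K s.Ω) n δ W → Dat p.K s.Ω (suppDomOfRecord F θ'.ν p.K s.Ω) n δ W)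
    (hseam : ∀ (θ' : Stage13Params F N) (p : B12.RunParams) (n : ℕ) (s : SeqOfRecord F θ'.ν θ'.τ9.M (gOfRecord₁₃ F N θ' p) p.K (n + 1)) (W : MSField (F.P p.K) (SU N)),
      UbgOfRecord₁₃CoP F N θ' p (n + 1) s W = UbgMSCoPOfRecordB F N θ'.ν θ'.τ9.M (gOfRecord₁₃ F N θ' p) p.K (n + 1) s W)
    (hbox : BetaLowerH bl γ (betaOfRecord₁₃ F N (theta13OfThm1CCMW F N j γ ε₀ ε₂₉ B₃ B₃' a₀ a₁)))
    (hbox' : BetaUpperH β' γ (betaOfRecord₁₃ F N (theta13OfThm1CCMW F N j γ ε₀ ε₂₉ B₃ B₃' a₀ a₁))) (hl : -bl * γ ^ 2 ≤ 3) (hβ' : β' * γ ^ 2 ≤ 3 / 4)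
    (hsolv : ∀ P : B12.RunParams, Step.InInterval γ P.K (gOfRecord₁₃ F N θ₀ P) → ∀ i, 1 ≤ i → i ≤ P.K →
      ∀ (s : SeqOfRecord F θ₀.ν θ₀.τ9.M (gOfRecord₁₃ F N θ₀ P) P.K i) (V : GaugeField (F.P P.K) i (SU N)),
      chiSeqOfRecord F N θ₀.ν θ₀.τ9.M (gOfRecord₁₃ F N θ₀ P) P.K i s V ≠ 0 →
      ∀ a ∈ cubesIn (fun a : ↥(cubeIndices (F.P P.K) (cubeSide (F.P P.K).L θ₀.ν.M₂ (RkOfRecord (F.P P.K).L θ₀.ν.r (gOfRecord₁₃ F N θ₀ P i)) i)) =>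
          cubeEnl (F.P P.K) (cubeSide (F.P P.K).L θ₀.ν.M₂ (RkOfRecord (F.P P.K).L θ₀.ν.r (gOfRecord₁₃ F N θ₀ P i)) i) a 0) (s.Ω i),
        ∃ U₀, IsMinimizer (avOfRecord F N P.K) {U | PlaqSmall (θ₀.ν.εreg * (F.P P.K).eta i ^ 2) U}
          (Bj θ₀.ν.M₁ (cubeEnl (F.P P.K) (cubeSide (F.P P.K).L θ₀.ν.M₂ (RkOfRecord (F.P P.K).L θ₀.ν.r (gOfRecord₁₃ F N θ₀ P i)) i) a 4) i)
          (avgFamily (avOfRecord F N P.K) (qsstarGIter0 i V)) U₀)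
    (σ : (P : B12.RunParams) → Sect3Supplier (gaussPinH (Stage13HParams.ofHistoryBlind F N ⟨θ₀, ZrOfRecord₁₃ F N θ₀⟩)) P)
    (hσ : ∀ P : B12.RunParams, Step.InInterval γ P.K (gOfRecord₁₃ F N θ₀ P) → SupplierObligations (gaussPinH (Stage13HParams.ofHistoryBlind F N ⟨θ₀, ZrOfRecord₁₃ F N θ₀⟩)) P (σ P))
    (hσB : ∀ P : B12.RunParams, Step.InInterval γ P.K (gOfRecord₁₃ F N θ₀ P) → SupplierBorel (gaussPinH (Stage13HParams.ofHistoryBlind F N ⟨θ₀, ZrOfRecord₁₃ F N θ₀⟩)) P (σ P))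
    (hG : (Stage13HParams.ofHistoryBlind F N ⟨θ₀, ZrOfRecord₁₃ F N θ₀⟩).Provisos₁₃SepCoPH F N)
    (w : WorldP) (hC : w.C = (datumOfRecord₁₃SepCoPH F N (gaussPinH (Stage13HParams.ofHistoryBlind F N ⟨θ₀, ZrOfRecord₁₃ F N θ₀⟩)) (provisos₁₃SepCoPH_gaussPinH hG)).C)
    (hγw : w.γ ≤ γ) (hn : ∀ P : B12.RunParams, Nodes (leavesP w P)) (c' : ℝ) : ∀ P : B12.RunParams, Nodes (leavesP (withCeiling w c') P) := by
  have hN := supplyChainAt_family_gaussPinH_door_ccmwCR_of_supplierBorel_of_betaBox hθ₀ hjm hc2 hc8 hj hε hε' hB hB' ha₀ ha₁ hγ0 hγe h3γ hRγ hε3γ hε2γ h15 hc₁₅ h9 hDat₀ hseam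
    hbox hbox' hl hβ' hsolv σ hσ hσB
  subst hθ₀
  have hγ1 : γ < 1 := hγe.trans_lt (Real.exp_lt_one_iff.mpr (by norm_num))
  have hpos := ccmwCR_pos (L := F.L) (j := j) (ε₀ := ε₀) (B₃ := B₃) (B₃' := B₃') (a₀ := a₀) (a₁ := a₁) (by have := F.hL11; omega) hγ0 hγ1
    (by linarith : (0 : ℝ) < c) hε hB hB' ha₀ ha₁
  have hadm := (admissible_theta13OfNumerics (n := ({ stage12NumericsOfThm1CCMW F.L j γ ε₀ B₃ B₃' a₀ a₁ with s2 := { sect2NumericsOfThm1C F.L with cR := c } } : Stage12Numerics)) F N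
    (zeta316OfRecord F N (stage12NumericsOfThm1CCMW F.L j γ ε₀ B₃ B₃' a₀ a₁).ν (stage12NumericsOfThm1CCMW F.L j γ ε₀ B₃ B₃' a₀ a₁).τ9.M
      (stage12NumericsOfThm1CCMW F.L j γ ε₀ B₃ B₃' a₀ a₁).A₁) (RzOfRecord F N) (ZtOfRecord F N) hpos hε').liveRepin₁₃
  have hM : 1 ≤ F.L ^ j := Nat.one_le_pow _ _ (by have := F.hL11; omega)
  have hκ : (0 : ℝ) ≤ 20000 := by norm_num
  exact nodes_leavesP_withCeiling_of_supplyChainAt_family _ (provisos₁₃SepCoPH_gaussPinH hG).toCore rfl hadm hκ zero_le_one zero_le_one hM hN w hC hγw hn c'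

/-! ## §3  dag-n24-c's `h11`-shaped (S1ᵀ) child family at the member's door -/

/-- **★★★★ N11's CHILD FAMILY IN THE `h11` SHAPE OF THE K1⁹-BY-NAME ROAD (dag-n24-c's binder VERBATIM with `θ := θᴳ_c`) AT THE cR-LETTERED MEMBER's HISTORY-BLIND DOOR**: for
every `(βup, β₀)` there is `γ₁₁ > 0` (`:= γ`) such that at EVERY world `w` bound to the SepCoPH datum of θᴳ_c with `w.βup = βup`, `w.β₀ = β₀`, `w.γ ≤ γ₁₁`, for EVERY run, under the
node's leaf antecedents (only `smallCouplings` read), the (S1ᵀ) slot `∀ k < K, SLaw₁₃CoPH θᴳ_c P k → TLaw₁₃CoPH θᴳ_c P k` — dag-n11-w1 g4's socket `h11Family_of_supplyChainAt_family` on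
§1's family.  Displayed: Part 14 §0c's letters ((8), the (9)-step, the sign-free β-box), `c ∈ [2, 8]`, `1 ≤ j`, `j + 1 ≤ F.m`, the γ-conditions, and ON THE WINDOWED RUNS K0's per-cube
[15]-solvability and [III] §3's supplier — NOTHING ELSE; `hG` = any proof of the door key (inhabited by g4's door theorem), naming the datum.  CONDITIONAL; nothing of Bałaban asserted;
no v9 stub touched.
[cite: Balaban1988Convergent, Theorem p.245, Thm 1 p.262, remark p.262, p.244 L36–38, §3 p.279, (2.6) p.255, (2.10) p.256, (2.28) p.259, (3.16)–(3.25) pp.268–270; Balaban1989LargeFieldII, Thm 1 + (0.1) pp.355–356; Balaban1989LargeFieldI, (0.2)–(0.4) p.176, p.177 (i)–(ii); Balaban1985Variational, Thm 1 (7)–(9) pp.278–279, (144)–(152) pp.300–301, Prop. 8 p.304; Balaban1987RG1, Thm 1 p.259, (0.20) p.256, (1.20)–(1.22) p.264] -/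
theorem h11Family_gaussPinH_door_ccmwCR_of_supplierBorel_of_betaBox
    (hθ₀ : θ₀ = theta13LiveOfNumerics F N
      ({ stage12NumericsOfThm1CCMW F.L j γ ε₀ B₃ B₃' a₀ a₁ with s2 := { sect2NumericsOfThm1C F.L with cR := c } } : Stage12Numerics) ε₂₉
      (zeta316OfRecord F N (stage12NumericsOfThm1CCMW F.L j γ ε₀ B₃ B₃' a₀ a₁).ν (stage12NumericsOfThm1CCMW F.L j γ ε₀ B₃ B₃' a₀ a₁).τ9.M
        (stage12NumericsOfThm1CCMW F.L j γ ε₀ B₃ B₃' a₀ a₁).A₁) (RzOfRecord F N) (ZtOfRecord F N))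
    (hjm : j + 1 ≤ F.m) (hc2 : 2 ≤ c) (hc8 : c ≤ 8) (hj : 1 ≤ j) (hε : 0 < ε₀) (hε' : 0 < ε₂₉) (hB : 0 ≤ B₃) (hB' : 0 ≤ B₃') (ha₀ : 0 < a₀) (ha₁ : 0 < a₁)
    (hγ0 : 0 < γ) (hγe : γ ≤ Real.exp (-1))
    (h3γ : 3 * (F.L : ℝ) ^ j ≤ F.L * Real.log (γ ^ 2)⁻¹) (hRγ : ((8 * F.L + 3 : ℕ) : ℝ) ≤ F.L * Real.log (γ ^ 2)⁻¹)
    (hε3γ : 36608 * (γ * Real.log (γ ^ 2)⁻¹) ≤ 16 / 3) (hε2γ : γ * Real.log (γ ^ 2)⁻¹ ≤ 16 * ExpMeanLog.deltaSU (Fin N) / ((8 * F.L : ℕ) : ℝ) ^ 2)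
    (h15 : VariationalThm1RegSepCoP7MGB F N (floorGuard F c₁₅) (lamDatum F) Dat B₃ a₀ a₁) (hc₁₅ : c₁₅ ≤ F.L ^ j)
    (h9 : Gauge9RegSepTopStepGB F N (fun ν K Ω => suppDomOfRecord F ν K Ω) (F.L ^ j) (floorGuard F c₁₅) (lamDatum F) Dat B₃ B₃' a₀ a₁)
    (hDat₀ : ∀ (θ' : Stage13Params F N) (p : B12.RunParams) (n : ℕ) (s : SeqOfRecord F θ'.ν θ'.τ9.M (gOfRecord₁₃ F N θ' p) p.K n) (δ : ℕ → ℝ) (W : MSField (F.P p.K) (SU N)),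
      n ≤ p.K → Sect2.DataSmall7PTop (avOfRecord F N p.K) s.Ω (suppDomOfRecord F θ'.ν p.K s.Ω) n δ W → Dat p.K s.Ω (suppDomOfRecord F θ'.ν p.K s.Ω) n δ W)
    (hseam : ∀ (θ' : Stage13Params F N) (p : B12.RunParams) (n : ℕ) (s : SeqOfRecord F θ'.ν θ'.τ9.M (gOfRecord₁₃ F N θ' p) p.K (n + 1)) (W : MSField (F.P p.K) (SU N)),
      UbgOfRecord₁₃CoP F N θ' p (n + 1) s W = UbgMSCoPOfRecordB F N θ'.ν θ'.τ9.M (gOfRecord₁₃ F N θ' p) p.K (n + 1) s W)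
    (hbox : BetaLowerH bl γ (betaOfRecord₁₃ F N (theta13OfThm1CCMW F N j γ ε₀ ε₂₉ B₃ B₃' a₀ a₁)))
    (hbox' : BetaUpperH β' γ (betaOfRecord₁₃ F N (theta13OfThm1CCMW F N j γ ε₀ ε₂₉ B₃ B₃' a₀ a₁))) (hl : -bl * γ ^ 2 ≤ 3) (hβ' : β' * γ ^ 2 ≤ 3 / 4)
    (hsolv : ∀ P : B12.RunParams, Step.InInterval γ P.K (gOfRecord₁₃ F N θ₀ P) → ∀ i, 1 ≤ i → i ≤ P.K →
      ∀ (s : SeqOfRecord F θ₀.ν θ₀.τ9.M (gOfRecord₁₃ F N θ₀ P) P.K i) (V : GaugeField (F.P P.K) i (SU N)),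
      chiSeqOfRecord F N θ₀.ν θ₀.τ9.M (gOfRecord₁₃ F N θ₀ P) P.K i s V ≠ 0 →
      ∀ a ∈ cubesIn (fun a : ↥(cubeIndices (F.P P.K) (cubeSide (F.P P.K).L θ₀.ν.M₂ (RkOfRecord (F.P P.K).L θ₀.ν.r (gOfRecord₁₃ F N θ₀ P i)) i)) =>
          cubeEnl (F.P P.K) (cubeSide (F.P P.K).L θ₀.ν.M₂ (RkOfRecord (F.P P.K).L θ₀.ν.r (gOfRecord₁₃ F N θ₀ P i)) i) a 0) (s.Ω i),
        ∃ U₀, IsMinimizer (avOfRecord F N P.K) {U | PlaqSmall (θ₀.ν.εreg * (F.P P.K).eta i ^ 2) U}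
          (Bj θ₀.ν.M₁ (cubeEnl (F.P P.K) (cubeSide (F.P P.K).L θ₀.ν.M₂ (RkOfRecord (F.P P.K).L θ₀.ν.r (gOfRecord₁₃ F N θ₀ P i)) i) a 4) i)
          (avgFamily (avOfRecord F N P.K) (qsstarGIter0 i V)) U₀)
    (σ : (P : B12.RunParams) → Sect3Supplier (gaussPinH (Stage13HParams.ofHistoryBlind F N ⟨θ₀, ZrOfRecord₁₃ F N θ₀⟩)) P)
    (hσ : ∀ P : B12.RunParams, Step.InInterval γ P.K (gOfRecord₁₃ F N θ₀ P) → SupplierObligations (gaussPinH (Stage13HParams.ofHistoryBlind F N ⟨θ₀, ZrOfRecord₁₃ F N θ₀⟩)) P (σ P))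
    (hσB : ∀ P : B12.RunParams, Step.InInterval γ P.K (gOfRecord₁₃ F N θ₀ P) → SupplierBorel (gaussPinH (Stage13HParams.ofHistoryBlind F N ⟨θ₀, ZrOfRecord₁₃ F N θ₀⟩)) P (σ P))
    (hG : (Stage13HParams.ofHistoryBlind F N ⟨θ₀, ZrOfRecord₁₃ F N θ₀⟩).Provisos₁₃SepCoPH F N) :
    ∀ βup β₀ : ℝ, ∃ γ₁₁ : ℝ, 0 < γ₁₁ ∧ ∀ w : WorldP,
      w.C = (datumOfRecord₁₃SepCoPH F N (gaussPinH (Stage13HParams.ofHistoryBlind F N ⟨θ₀, ZrOfRecord₁₃ F N θ₀⟩)) (provisos₁₃SepCoPH_gaussPinH hG)).C →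
      w.βup = βup → w.β₀ = β₀ → w.γ ≤ γ₁₁ →
      ∀ P : B12.RunParams, (leavesP w P).b7 → (leavesP w P).b8 → (leavesP w P).b9 → (leavesP w P).b10 → (leavesP w P).b11 →
      (leavesP w P).smallCouplings → (leavesP w P).smallFieldInductive → (leavesP w P).flowControl →
        ∀ k, k < P.K → SLaw₁₃CoPH F N (gaussPinH (Stage13HParams.ofHistoryBlind F N ⟨θ₀, ZrOfRecord₁₃ F N θ₀⟩)) P k →
          TLaw₁₃CoPH F N (gaussPinH (Stage13HParams.ofHistoryBlind F N ⟨θ₀, ZrOfRecord₁₃ F N θ₀⟩)) P k := by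
  have hN := supplyChainAt_family_gaussPinH_door_ccmwCR_of_supplierBorel_of_betaBox hθ₀ hjm hc2 hc8 hj hε hε' hB hB' ha₀ ha₁ hγ0 hγe h3γ hRγ hε3γ hε2γ h15 hc₁₅ h9 hDat₀ hseam
    hbox hbox' hl hβ' hsolv σ hσ hσB
  subst hθ₀
  have hγ1 : γ < 1 := hγe.trans_lt (Real.exp_lt_one_iff.mpr (by norm_num))
  have hpos := ccmwCR_pos (L := F.L) (j := j) (ε₀ := ε₀) (B₃ := B₃) (B₃' := B₃') (a₀ := a₀) (a₁ := a₁) (by have := F.hL11; omega) hγ0 hγ1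
    (by linarith : (0 : ℝ) < c) hε hB hB' ha₀ ha₁
  have hadm := (admissible_theta13OfNumerics (n := ({ stage12NumericsOfThm1CCMW F.L j γ ε₀ B₃ B₃' a₀ a₁ with s2 := { sect2NumericsOfThm1C F.L with cR := c } } : Stage12Numerics)) F N
    (zeta316OfRecord F N (stage12NumericsOfThm1CCMW F.L j γ ε₀ B₃ B₃' a₀ a₁).ν (stage12NumericsOfThm1CCMW F.L j γ ε₀ B₃ B₃' a₀ a₁).τ9.M
      (stage12NumericsOfThm1CCMW F.L j γ ε₀ B₃ B₃' a₀ a₁).A₁) (RzOfRecord F N) (ZtOfRecord F N) hpos hε').liveRepin₁₃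
  have hM : 1 ≤ F.L ^ j := Nat.one_le_pow _ _ (by have := F.hL11; omega)
  have hκ : (0 : ℝ) ≤ 20000 := by norm_num
  exact h11Family_of_supplyChainAt_family _ (provisos₁₃SepCoPH_gaussPinH hG) rfl hadm hκ zero_le_one zero_le_one hM hγ0 hN

/-! ## §4  «γ sufficiently small» quantified for the `h11` family at the door -/

/-- **★★★★ «γ SUFFICIENTLY SMALL» QUANTIFIED — THE `h11` FAMILY AT THE cR-LETTERED MEMBER's HISTORY-BLIND DOOR FOR EVERY `c ∈ [2, 8]` AND EVERY WINDOW LETTER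
`γ ∈ ]0, γ₁₁ⁿᵘᵐ(L, j, N)]`** (`1 ≤ j`, `j + 1 ≤ F.m`; g3's `exists_window_ccmShape` supplies the five γ-conditions of §3): for every such `γ`, `c`, [15]'s signs, Part 14 §0c's letters and —
on the windowed runs — K0's per-cube [15]-solvability and a [III] §3 supplier: the door key HOLDS (g4's door theorem) ∧ for EVERY key proof `hG` the `h11` family of §3 at the datum keyed
by `hG`.  CONDITIONAL; nothing of Bałaban asserted.
[cite: Balaban1988Convergent, Theorem p.245, Thm 1 p.262, remark p.262, §3 p.279, (2.4)–(2.5) p.255, (2.10) p.256, (2.28) p.259; Balaban1987RG1, Thm 1 p.259 («contained in an interval ]0, γ] with a sufficiently small positive γ»), (1.20)–(1.22) p.264; Balaban1989LargeFieldII, Thm 1 + (0.1) pp.355–356; Balaban1989LargeFieldI, (0.2)–(0.4) p.176; Balaban1985Variational, Thm 1 (7)–(9) pp.278–279, (144)–(152) pp.300–301] -/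
theorem exists_window_h11Family_gaussPinH_door_ccmwCR_of_betaBox (F : T4Family) (N : ℕ) [NeZero N] {j : ℕ} (hj : 1 ≤ j) (hjm : j + 1 ≤ F.m) :
    ∃ γ₀ : ℝ, 0 < γ₀ ∧ ∀ (Dat : TopData F N) (γ c ε₀ ε₂₉ B₃ B₃' a₀ a₁ bl β' : ℝ) (c₁₅ : ℕ) (hc : 2 ≤ c) (hc8 : c ≤ 8) (hε : 0 < ε₀) (hε' : 0 < ε₂₉) (hB : 0 ≤ B₃) (hB' : 0 ≤ B₃')
      (ha₀ : 0 < a₀) (ha₁ : 0 < a₁) (hγ : 0 < γ) (hγle : γ ≤ γ₀) (h15 : VariationalThm1RegSepCoP7MGB F N (floorGuard F c₁₅) (lamDatum F) Dat B₃ a₀ a₁) (hc₁₅ : c₁₅ ≤ F.L ^ j)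
      (h9 : Gauge9RegSepTopStepGB F N (fun ν K Ω => suppDomOfRecord F ν K Ω) (F.L ^ j) (floorGuard F c₁₅) (lamDatum F) Dat B₃ B₃' a₀ a₁)
    (hDat₀ : ∀ (θ' : Stage13Params F N) (p : B12.RunParams) (n : ℕ) (s : SeqOfRecord F θ'.ν θ'.τ9.M (gOfRecord₁₃ F N θ' p) p.K n) (δ : ℕ → ℝ) (W : MSField (F.P p.K) (SU N)),
      n ≤ p.K → Sect2.DataSmall7PTop (avOfRecord F N p.K) s.Ω (suppDomOfRecord F θ'.ν p.K s.Ω) n δ W → Dat p.K s.Ω (suppDomOfRecord F θ'.ν p.K s.Ω) n δ W)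
    (hseam : ∀ (θ' : Stage13Params F N) (p : B12.RunParams) (n : ℕ) (s : SeqOfRecord F θ'.ν θ'.τ9.M (gOfRecord₁₃ F N θ' p) p.K (n + 1)) (W : MSField (F.P p.K) (SU N)),
      UbgOfRecord₁₃CoP F N θ' p (n + 1) s W = UbgMSCoPOfRecordB F N θ'.ν θ'.τ9.M (gOfRecord₁₃ F N θ' p) p.K (n + 1) s W)
      (hbox : BetaLowerH bl γ (betaOfRecord₁₃ F N (theta13OfThm1CCMW F N j γ ε₀ ε₂₉ B₃ B₃' a₀ a₁)))
      (hbox' : BetaUpperH β' γ (betaOfRecord₁₃ F N (theta13OfThm1CCMW F N j γ ε₀ ε₂₉ B₃ B₃' a₀ a₁))) (hl : -bl * γ ^ 2 ≤ 3) (hβ' : β' * γ ^ 2 ≤ 3 / 4)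
      (θ₀ : Stage13Params F N) (hθ₀ : θ₀ = theta13LiveOfNumerics F N
          ({ stage12NumericsOfThm1CCMW F.L j γ ε₀ B₃ B₃' a₀ a₁ with s2 := { sect2NumericsOfThm1C F.L with cR := c } } : Stage12Numerics) ε₂₉
          (zeta316OfRecord F N (stage12NumericsOfThm1CCMW F.L j γ ε₀ B₃ B₃' a₀ a₁).ν (stage12NumericsOfThm1CCMW F.L j γ ε₀ B₃ B₃' a₀ a₁).τ9.M
            (stage12NumericsOfThm1CCMW F.L j γ ε₀ B₃ B₃' a₀ a₁).A₁) (RzOfRecord F N) (ZtOfRecord F N)),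
      (∀ P : B12.RunParams, Step.InInterval γ P.K (gOfRecord₁₃ F N θ₀ P) → ∀ i, 1 ≤ i → i ≤ P.K →
        ∀ (s : SeqOfRecord F θ₀.ν θ₀.τ9.M (gOfRecord₁₃ F N θ₀ P) P.K i) (V : GaugeField (F.P P.K) i (SU N)),
        chiSeqOfRecord F N θ₀.ν θ₀.τ9.M (gOfRecord₁₃ F N θ₀ P) P.K i s V ≠ 0 →
        ∀ a ∈ cubesIn (fun a : ↥(cubeIndices (F.P P.K) (cubeSide (F.P P.K).L θ₀.ν.M₂ (RkOfRecord (F.P P.K).L θ₀.ν.r (gOfRecord₁₃ F N θ₀ P i)) i)) =>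
            cubeEnl (F.P P.K) (cubeSide (F.P P.K).L θ₀.ν.M₂ (RkOfRecord (F.P P.K).L θ₀.ν.r (gOfRecord₁₃ F N θ₀ P i)) i) a 0) (s.Ω i),
          ∃ U₀, IsMinimizer (avOfRecord F N P.K) {U | PlaqSmall (θ₀.ν.εreg * (F.P P.K).eta i ^ 2) U}
            (Bj θ₀.ν.M₁ (cubeEnl (F.P P.K) (cubeSide (F.P P.K).L θ₀.ν.M₂ (RkOfRecord (F.P P.K).L θ₀.ν.r (gOfRecord₁₃ F N θ₀ P i)) i) a 4) i)
            (avgFamily (avOfRecord F N P.K) (qsstarGIter0 i V)) U₀) →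
      ∀ (σ : (P : B12.RunParams) → Sect3Supplier (gaussPinH (Stage13HParams.ofHistoryBlind F N ⟨θ₀, ZrOfRecord₁₃ F N θ₀⟩)) P),
      (∀ P : B12.RunParams, Step.InInterval γ P.K (gOfRecord₁₃ F N θ₀ P) → SupplierObligations (gaussPinH (Stage13HParams.ofHistoryBlind F N ⟨θ₀, ZrOfRecord₁₃ F N θ₀⟩)) P (σ P)) →
      (∀ P : B12.RunParams, Step.InInterval γ P.K (gOfRecord₁₃ F N θ₀ P) → SupplierBorel (gaussPinH (Stage13HParams.ofHistoryBlind F N ⟨θ₀, ZrOfRecord₁₃ F N θ₀⟩)) P (σ P)) →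
      (Stage13HParams.ofHistoryBlind F N ⟨θ₀, ZrOfRecord₁₃ F N θ₀⟩).Provisos₁₃SepCoPH F N ∧
      ∀ hG : (Stage13HParams.ofHistoryBlind F N ⟨θ₀, ZrOfRecord₁₃ F N θ₀⟩).Provisos₁₃SepCoPH F N,
      ∀ βup β₀ : ℝ, ∃ γ₁₁ : ℝ, 0 < γ₁₁ ∧ ∀ w : WorldP,
        w.C = (datumOfRecord₁₃SepCoPH F N (gaussPinH (Stage13HParams.ofHistoryBlind F N ⟨θ₀, ZrOfRecord₁₃ F N θ₀⟩)) (provisos₁₃SepCoPH_gaussPinH hG)).C →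
        w.βup = βup → w.β₀ = β₀ → w.γ ≤ γ₁₁ →
        ∀ P : B12.RunParams, (leavesP w P).b7 → (leavesP w P).b8 → (leavesP w P).b9 → (leavesP w P).b10 → (leavesP w P).b11 →
        (leavesP w P).smallCouplings → (leavesP w P).smallFieldInductive → (leavesP w P).flowControl →
          ∀ k, k < P.K → SLaw₁₃CoPH F N (gaussPinH (Stage13HParams.ofHistoryBlind F N ⟨θ₀, ZrOfRecord₁₃ F N θ₀⟩)) P k →
            TLaw₁₃CoPH F N (gaussPinH (Stage13HParams.ofHistoryBlind F N ⟨θ₀, ZrOfRecord₁₃ F N θ₀⟩)) P k := by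
  obtain ⟨γ₀, hγ₀, hall⟩ := exists_window_ccmShape (L := F.L) F.hL.2.le j N
  refine ⟨γ₀, hγ₀, fun Dat γ c ε₀ ε₂₉ B₃ B₃' a₀ a₁ bl β' c₁₅ hc hc8 hε hε' hB hB' ha₀ ha₁ hγ hγle h15 hc₁₅ h9 hDat₀ hseam hbox hbox' hl hβ' θ₀ hθ₀ hsolv σ hσ hσB => ?_⟩
  obtain ⟨hγe, h3γ, hRγ, hε3γ, hε2γ⟩ := hall γ hγ hγle
  exact ⟨provisos₁₃SepCoPH_door_ccmwCR_of_gauge9TopStepGB_of_betaBoxSignFree_allTorus_lam hθ₀ (by linarith) hc8 hγ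
      (hγe.trans (Real.exp_neg_one_lt_d9.le.trans (by norm_num))) hε hε' hB hB' ha₀ ha₁ h15 h9 (hAdm_floorGuard_ccmwCR hθ₀ hc₁₅) (fun θ' p n s δ W hn _ h => hDat₀ θ' p n s δ W hn h) hseam hbox hbox' hl hβ',
    fun hG => h11Family_gaussPinH_door_ccmwCR_of_supplierBorel_of_betaBox hθ₀ hjm hc hc8 hj hε hε' hB hB' ha₀ ha₁ hγ hγe h3γ hRγ hε3γ hε2γ h15 hc₁₅ h9 hDat₀ hseam
      hbox hbox' hl hβ' hsolv σ hσ hσB hG⟩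

end Summit.QuantumFields.YangMills.Theorems.BalabanUVNodesN11NodeFacesAtCRLetteredMemberDoorOfBgFactsB

end
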